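import Literature.MathematicalPhysics.QuantumLattice.VariationalEquilibriumCoexistenceInterval
import Literature.MathematicalPhysics.QuantumLattice.HubbardTTPrimeThermalPressureZeemanStates
import HarnessLib

/-!
# The density coexistence interval of the 2D `t–t'` Hubbard model at `(β; μ, h)`: every density between the one-sided
# `μ`-derivatives of the grand-canonical pressure is carried by an equilibrium state, and only those

Topic `MathematicalPhysics/QuantumLattice` (family `hubbard`; stage S2 (iii) `T > 0`, competing orders / phase separation on the `T × H` axes).
The `t–t'` reading of `VariationalEquilibriumCoexistenceInterval` (model-free: conjugate densities of the equilibria at a coupling fill exactly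
the subdifferential of the directional pressure) through the grand-canonical family `gcInteractionTT' t t' U μ h = Φ(t,t',U) − μn − h(n↑−n↓)`
(direction `0` = `−μ`, `gcInteractionTT'_update_mu`) and `varPressure_gcInteractionTT'_eq : P_var = gcPressureTT'Zeeman`. With `s_k = 1/(k+1)` and
`P(μ) = gcPressureTT'Zeeman β t t' U μ h` (`β > 0`, `U ≥ 0`):

* `IsVarEquilibrium.density_quotient_bounds_gcInteractionTT'`: every equilibrium `ω` at `(μ,h)` has, for every `k`,
  `(P(μ) − P(μ − s_k))/s_k ≤ β ρ(ω) ≤ (P(μ + s_k) − P(μ))/s_k`;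
* **`exists_isVarEquilibrium_gcInteractionTT'_density_eq_of_quotient_bounds`**: conversely every `ρ` with
  `(P(μ) − P(μ − s_k))/s_k ≤ βρ ≤ (P(μ + s_k) − P(μ))/s_k` for ALL `k` is the density of an equilibrium state at `(μ, h)`.

So the densities of the grand-canonical equilibrium states at `(β; μ, h)` form EXACTLY the interval `[ρ₋(μ), ρ₊(μ)]` between the one-sided
`μ`-derivatives of `P/β` — a density jump (first-order transition / phase separation in the thermodynamic limit) comes with equilibrium states of
every intermediate density, and certified pressures at `μ ± s` bound the interval from outside (pointwise hypotheses, no limits needed).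

HONEST SCOPE: existence/characterisation of infinite-volume equilibrium states; no uniqueness, no certificate value, no phase word, no definition.
Everything PROVED, 0 sorry.

## Mathlib / tree search
REUSED: `IsVarEquilibrium.neg_mul_meanEnergy_mem_Icc_oneSided`, `exists_isVarEquilibrium_neg_mul_meanEnergy_eq_of_mem_Icc`, `bddBelow_rightQuotients`,
`bddAbove_leftQuotients` (CoexistenceInterval), `gcInteractionTT'_update_mu`, `varPressure_gcInteractionTT'_eq`, `meanEnergy_numberInteraction`;
Mathlib `ciSup_le`, `le_ciInf`, `le_ciSup`, `ciInf_le`.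

## References
* R. B. Israel, *Convexity in the Theory of Lattice Gases* (1979), Thm. I.2.4, §V.1. [cite: Israel1979, Thm. I.2.4]
* D. Ruelle, *Statistical Mechanics: Rigorous Results* (1969), §3.4. [cite: Ruelle1969, §3.4]
-/

noncomputable section

namespace Literature.MathematicalPhysics.QuantumLattice

open _root_.Filter Set InfVolFermionState ThermodynamicLimit
open scoped _root_.Topology

section Hubbard

variable {β : ℝ} (hβ : 0 < β) (t t' : ℝ) {U : ℝ} (hU : 0 ≤ U) (μ hz : ℝ)
include hβ hU

/-- The directional pressure of the grand-canonical family in direction `0` (shift `δ`) is `P(μ − δ, h)`. [cite: Ruelle1969, §3.4] -/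
private theorem varPressure_shift_eq (δ : ℝ) :
    (FermionInteraction.linearFamily (hubbardTTPrimeFermionInteraction t t' U) ![numberInteraction 2, spinImbalanceInteraction 2]
      (![-μ, -hz] + Pi.single 0 δ)).varPressure β 1 = gcPressureTT'Zeeman β t t' U (μ - δ) hz := by
  rw [gcInteractionTT'_update_mu, varPressure_gcInteractionTT'_eq hβ.le t t' hU]

omit hβ hU in
/-- At shift `0` it is the grand-canonical interaction itself. [cite: Ruelle1969, §3.4] -/
private theorem linearFamily_base_eq :
    FermionInteraction.linearFamily (hubbardTTPrimeFermionInteraction t t' U) ![numberInteraction 2, spinImbalanceInteraction 2] ![-μ, -hz] =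
      gcInteractionTT' t t' U μ hz := rfl

/-- **Every equilibrium's density sits between the one-sided `μ`-quotients**: for every equilibrium `ω` at `(β; μ, h)` and every `k`,
`(P(μ) − P(μ − s_k))/s_k ≤ βρ(ω) ≤ (P(μ + s_k) − P(μ))/s_k`, `s_k = 1/(k+1)`. [cite: Israel1979, Thm. I.2.4] -/
theorem IsVarEquilibrium.density_quotient_bounds_gcInteractionTT' {ω : InfVolFermionState 2}
    (hω : ω.IsVarEquilibrium β (gcInteractionTT' t t' U μ hz) 1) (k : ℕ) :
    (gcPressureTT'Zeeman β t t' U μ hz - gcPressureTT'Zeeman β t t' U (μ - 1 / ((k : ℝ) + 1)) hz) / (1 / ((k : ℝ) + 1)) ≤ β * ω.density ∧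
      β * ω.density ≤ (gcPressureTT'Zeeman β t t' U (μ + 1 / ((k : ℝ) + 1)) hz - gcPressureTT'Zeeman β t t' U μ hz) / (1 / ((k : ℝ) + 1)) := by
  have hs : (0 : ℝ) < 1 / ((k : ℝ) + 1) := by positivity
  have hω' : ω.IsVarEquilibrium β (FermionInteraction.linearFamily (hubbardTTPrimeFermionInteraction t t' U)
      ![numberInteraction 2, spinImbalanceInteraction 2] ![-μ, -hz]) 1 := by rw [linearFamily_base_eq]; exact hω
  have h1 := hω'.varPressure_sub_mul_le_update 0 (1 / ((k : ℝ) + 1))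
  have h2 := hω'.varPressure_sub_mul_le_update 0 (-(1 / ((k : ℝ) + 1)))
  rw [varPressure_shift_eq hβ t t' hU, linearFamily_base_eq, varPressure_gcInteractionTT'_eq hβ.le t t' hU] at h1 h2
  simp only [Matrix.cons_val_zero, meanEnergy_numberInteraction, sub_neg_eq_add] at h1 h2
  constructor
  · rw [div_le_iff₀ hs]; linarith [h1]
  · rw [le_div_iff₀ hs]; linarith [h2]

/-- **THE DENSITY COEXISTENCE INTERVAL IS FILLED**: if `(P(μ) − P(μ − s_k))/s_k ≤ βρ ≤ (P(μ + s_k) − P(μ))/s_k` for every `k` (`s_k = 1/(k+1)`),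
then some variational equilibrium state at `(β; t,t',U; μ, h)` has density EXACTLY `ρ` (`β > 0`, `U ≥ 0`). With the previous theorem the set of
densities of the equilibria at `(μ,h)` is exactly this interval. [cite: Israel1979, Thm. I.2.4] -/
theorem exists_isVarEquilibrium_gcInteractionTT'_density_eq_of_quotient_bounds {ρ : ℝ}
    (hlo : ∀ k : ℕ, (gcPressureTT'Zeeman β t t' U μ hz - gcPressureTT'Zeeman β t t' U (μ - 1 / ((k : ℝ) + 1)) hz) / (1 / ((k : ℝ) + 1)) ≤ β * ρ)
    (hhi : ∀ k : ℕ, β * ρ ≤ (gcPressureTT'Zeeman β t t' U (μ + 1 / ((k : ℝ) + 1)) hz - gcPressureTT'Zeeman β t t' U μ hz) / (1 / ((k : ℝ) + 1))) :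
    ∃ ω : InfVolFermionState 2, ω.IsVarEquilibrium β (gcInteractionTT' t t' U μ hz) 1 ∧ ω.density = ρ := by
  set Ψ₀ := hubbardTTPrimeFermionInteraction t t' U
  set Ψv : Fin 2 → FermionInteraction 2 := ![numberInteraction 2, spinImbalanceInteraction 2]
  set θ : Fin 2 → ℝ := ![-μ, -hz]
  have hs : ∀ k : ℕ, (0 : ℝ) < 1 / ((k : ℝ) + 1) := fun k => by positivity
  -- the θ-direction quotients are the μ-quotients with μ ↦ μ − δ
  have hQ : ∀ k : ℕ, ((FermionInteraction.linearFamily Ψ₀ Ψv (θ + Pi.single 0 (1 / ((k : ℝ) + 1)))).varPressure β 1 -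
      (FermionInteraction.linearFamily Ψ₀ Ψv θ).varPressure β 1) / (1 / ((k : ℝ) + 1)) =
      (gcPressureTT'Zeeman β t t' U (μ - 1 / ((k : ℝ) + 1)) hz - gcPressureTT'Zeeman β t t' U μ hz) / (1 / ((k : ℝ) + 1)) := by
    intro k
    rw [varPressure_shift_eq hβ t t' hU, linearFamily_base_eq, varPressure_gcInteractionTT'_eq hβ.le t t' hU]
  have hP : ∀ k : ℕ, ((FermionInteraction.linearFamily Ψ₀ Ψv θ).varPressure β 1 -
      (FermionInteraction.linearFamily Ψ₀ Ψv (θ + Pi.single 0 (-(1 / ((k : ℝ) + 1))))).varPressure β 1) / (1 / ((k : ℝ) + 1)) =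
      (gcPressureTT'Zeeman β t t' U μ hz - gcPressureTT'Zeeman β t t' U (μ + 1 / ((k : ℝ) + 1)) hz) / (1 / ((k : ℝ) + 1)) := by
    intro k
    rw [varPressure_shift_eq hβ t t' hU, linearFamily_base_eq, varPressure_gcInteractionTT'_eq hβ.le t t' hU, sub_neg_eq_add]
  -- `x = −βρ` lies in `[D₋, D₊]` of the θ-direction
  have hlo' : (⨆ k : ℕ, ((FermionInteraction.linearFamily Ψ₀ Ψv θ).varPressure β 1 -
      (FermionInteraction.linearFamily Ψ₀ Ψv (θ + Pi.single 0 (-(1 / ((k : ℝ) + 1))))).varPressure β 1) / (1 / ((k : ℝ) + 1))) ≤ -(β * ρ) := by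
    refine ciSup_le fun k => ?_
    rw [hP k, div_le_iff₀ (hs k)]
    have h := hhi k
    rw [le_div_iff₀ (hs k)] at h
    linarith
  have hhi' : -(β * ρ) ≤ ⨅ k : ℕ, ((FermionInteraction.linearFamily Ψ₀ Ψv (θ + Pi.single 0 (1 / ((k : ℝ) + 1)))).varPressure β 1 -
      (FermionInteraction.linearFamily Ψ₀ Ψv θ).varPressure β 1) / (1 / ((k : ℝ) + 1)) := by
    refine le_ciInf fun k => ?_
    rw [hQ k, le_div_iff₀ (hs k)]
    have h := hlo k
    rw [div_le_iff₀ (hs k)] at h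
    linarith
  obtain ⟨ω, hω, he⟩ := exists_isVarEquilibrium_neg_mul_meanEnergy_eq_of_mem_Icc β Ψ₀ Ψv 1 θ 0 (by norm_num : 0 < 2) hlo' hhi'
  refine ⟨ω, by rw [← linearFamily_base_eq]; exact hω, ?_⟩
  have : β * ω.density = β * ρ := by
    have h2 : Ψv 0 = numberInteraction 2 := rfl
    rw [h2, meanEnergy_numberInteraction] at he
    linarith
  exact mul_left_cancel₀ hβ.ne' this

end Hubbard

end Literature.MathematicalPhysics.QuantumLattice
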